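import Literature.Algebra.EuclideanLattices.GaussianLatticeSums
import Literature.Algebra.EuclideanLattices.ARVerifierAlgebra
import HarnessLib

/-!
# Moments of the dual discrete Gaussian: directional second moments and the distance-to-`ℤ` statistic

Topic `Algebra/EuclideanLattices` (family `pqc`; serves the decomposition of Aharonov–Regev 2005,
Thm. 1.1, coNP part = `gapCVP_sqrt_mem_promiseCoNP` → `Literature.Barriers.PneNP.LatticeGapCoNP`).
Everything PROVED, from the shifted Poisson identity of `GaussianLatticeSums.lean`. Notation as
there: `ρ_s = gaussianFunction s`, `L*` = `dualLattice L`; the weights `ρ_{1/s}(w)`, `w ∈ L*`, are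
(up to normalisation) the discrete Gaussian `D_{L*,1/s}` from which Aharonov–Regev's witness
vectors are sampled, and `f_s(x) = ρ_s(L - x)/ρ_s(L) = E_{w ∼ D_{L*,1/s}}[cos(2π⟪x, w⟫)]`
(AR05 Claim 4.1; `tsum_gaussianFunction_sub_div_eq`).

These are the two expectation bounds behind the COMPLETENESS of the tree's integer-arithmetic
variant of the Aharonov–Regev verifier (see `ARVerifierAlgebra.lean` and the provefact notes of
`LatticeGapCoNP`):

* `gaussianFunction_mul_tsum_le_tsum_mul_cos` — `ρ_s(x) ≤ E cos(2π⟪x, w⟫)` (AR05 Lemma 3.2,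
  `f(x) ≥ e^{-π‖x‖²}`, on the dual side).
* `tsum_gaussianFunction_mul_indicator_inner_sq_le` — **directional second moments of the
  truncated samples**: `E[⟪u, w⟫² 1_{‖w‖ ≤ R}] ≤ π/(8s²)` for `‖u‖ ≤ 1` and every `R > 0`. In print
  this role is played by Lemma 2.6 = Banaszczyk 1993, Lemma 1.3 (`E⟪u, w⟫² ≤ 1/(2π)` without
  truncation), used inside Lemma 6.2 only through the truncated vectors `ξ(w)`; here the truncated
  bound is derived from Lemma 3.2 at `x = u/(2R)` and the chord inequality `cos θ ≤ 1 - 2θ²/π²`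
  (`|θ| ≤ π`), so that no second Poisson computation is needed. The constant `π/8` replaces `1/(2π)`.
* `one_sub_div_mul_tsum_le_tsum_mul_distInt_sq` — **the distance-to-`ℤ` statistic is large at far
  points**: `E[‖⟪x, w⟫‖²_{ℝ/ℤ}] ≥ (1 - f_s(x))/(2π²)`, from `cos(2πt) ≥ 1 - 2π²‖t‖²_{ℝ/ℤ}`; combined
  with AR05 Lemma 3.1 (`f_s(x) ≤ 2^{-Ω(n)}` when `dist(x, L) ≥ c s √n`,
  `tsum_gaussianFunction_sub_le_pow_mul_of_forall_le`) this is the completeness of the cosine-free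
  replacement of test (a) `f_W(v) < 1/2` (AR05 Claim 6.1).

## References

* D. Aharonov, O. Regev, *Lattice problems in NP ∩ coNP*, J. ACM 52 (2005) 749–765, Lemma 2.6,
  Lemma 3.2, Claim 4.1, Lemma 1.3, Claim 6.1, Lemma 6.2 (pp. 8–12 of the preprint).
* W. Banaszczyk, *New bounds in some transference theorems in the geometry of numbers*,
  Math. Ann. 296 (1993), Lemma 1.3.
-/

noncomputable section

open MeasureTheory Module Literature.NumberTheory.Sieve.Vinogradov
open scoped Real InnerProductSpace

namespace Literature.Algebra.EuclideanLattices

variable {V : Type*} [NormedAddCommGroup V] [InnerProductSpace ℝ V] [FiniteDimensional ℝ V]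
  [MeasurableSpace V] [BorelSpace V]

variable (L : Submodule ℤ V) [DiscreteTopology L] [IsZLattice ℝ L]

/-! ### The cosine average dominates the Gaussian (Aharonov–Regev Lemma 3.2 on the dual side) -/

omit [MeasurableSpace V] [BorelSpace V] in
/-- Summability of `w ↦ ρ_r(w) g(w)` over a lattice for bounded `g`. [folklore] -/
theorem summable_gaussianFunction_mul_of_bounded (Λ : Submodule ℤ V) [DiscreteTopology Λ] {r : ℝ} (hr : r ≠ 0)
    {g : Λ → ℝ} {C : ℝ} (hg : ∀ w, |g w| ≤ C) : Summable fun w : Λ ↦ gaussianFunction r (w : V) * g w := by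
  refine Summable.of_norm_bounded (((summable_gaussianFunction_sub Λ hr (0 : V)).congr fun w ↦ by
    rw [sub_zero]).mul_right C) fun w ↦ ?_
  rw [Real.norm_eq_abs, abs_mul, abs_of_pos (gaussianFunction_pos _ _)]
  exact mul_le_mul_of_nonneg_left (hg w) (gaussianFunction_pos _ _).le

/-- **The dual cosine average is at least the Gaussian**: for every `x` and `s > 0`,
`ρ_s(x) · ρ_{1/s}(L*) ≤ ∑_{w ∈ L*} ρ_{1/s}(w) cos(2π⟪x, w⟫)` — Aharonov–Regev's `f(x) ≥ e^{-π‖x‖²}`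
(Lemma 3.2) read through `f(x) = E_{w ∼ D_{L*}}[cos(2π⟨w, x⟩)]` (Claim 4.1).
[cite: AharonovRegev2005, Lemma 3.2 and Claim 4.1 (p. 9)] -/
theorem gaussianFunction_mul_tsum_le_tsum_mul_cos {s : ℝ} (hs : 0 < s) (x : V) :
    gaussianFunction s x * ∑' w : dualLattice L, gaussianFunction s⁻¹ (w : V) ≤
      ∑' w : dualLattice L, gaussianFunction s⁻¹ (w : V) * Real.cos (2 * π * ⟪x, (w : V)⟫_ℝ) := by
  have hZ : 0 < ∑' y : L, gaussianFunction s (y : V) := by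
    have := tsum_gaussianFunction_sub_pos L hs.ne' (0 : V)
    simpa only [sub_zero] using this
  have hZ' : 0 < ∑' w : dualLattice L, gaussianFunction s⁻¹ (w : V) := by
    have := tsum_gaussianFunction_sub_pos (dualLattice L) (inv_ne_zero hs.ne') (0 : V)
    simpa only [sub_zero] using this
  -- `ρ_s(x) ≤ ρ_s(L - x)/ρ_s(L) = (∑ ρ_{1/s}(w) cos)/ρ_{1/s}(L*)`
  have h1 : gaussianFunction s x ≤ (∑' y : L, gaussianFunction s ((y : V) - x)) / ∑' y : L, gaussianFunction s (y : V) := by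
    rw [le_div_iff₀ hZ]
    exact gaussianFunction_mul_tsum_le L hs.ne' x
  rw [tsum_gaussianFunction_sub_div_eq L hs x, le_div_iff₀ hZ'] at h1
  exact h1

/-! ### Directional second moments of the truncated dual Gaussian (in place of Banaszczyk's Lemma 1.3) -/

/-- **Directional second moment of the truncated dual discrete Gaussian**: for `s > 0`,
`‖u‖ ≤ 1` and any truncation radius `R > 0`,
`∑_{w ∈ L*, ‖w‖ ≤ R} ρ_{1/s}(w) ⟪u, w⟫² ≤ (π/(8s²)) ρ_{1/s}(L*)`, i.e.
`E_{w ∼ D_{L*,1/s}}[⟪u, w⟫² · 1_{‖w‖ ≤ R}] ≤ π/(8s²)`. This replaces, for the purposes of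
Aharonov–Regev's Lemma 6.2 (which needs SOME constant bound `r²` on the directional second moments
of the truncated samples `ξ(w)`), their Lemma 2.6 = Banaszczyk 1993, Lemma 1.3
(`E⟪u, w⟫² ≤ 1/(2π)`, untruncated, proved in print by a second Poisson computation): here it
follows from Lemma 3.2 at the point `x = u/(2R)` — `ρ_s(u/2R) ≤ E cos(2π⟪x, w⟫)` — and the chord
bound `cos θ ≤ 1 - 2θ²/π²` on `|θ| ≤ π`, valid on the truncated range, with `1 - e^{-a} ≤ a`.
[cite: AharonovRegev2005, Lemma 2.6 and Lemma 6.2 (pp. 8, 11) — variant] -/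
theorem tsum_gaussianFunction_mul_indicator_inner_sq_le {s : ℝ} (hs : 0 < s) {u : V} (hu : ‖u‖ ≤ 1) {R : ℝ}
    (hR : 0 < R) :
    ∑' w : dualLattice L, gaussianFunction s⁻¹ (w : V) *
        {w : dualLattice L | ‖(w : V)‖ ≤ R}.indicator (fun w ↦ ⟪u, (w : V)⟫_ℝ ^ 2) w ≤
      π / (8 * s ^ 2) * ∑' w : dualLattice L, gaussianFunction s⁻¹ (w : V) := by
  set Λ := dualLattice L
  have hs' : s⁻¹ ≠ 0 := inv_ne_zero hs.ne'
  set τ : ℝ := 1 / (2 * R) with hτ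
  have hτ0 : 0 < τ := by positivity
  set Z : ℝ := ∑' w : Λ, gaussianFunction s⁻¹ (w : V) with hZdef
  set g : Λ → ℝ := fun w ↦ {w : Λ | ‖(w : V)‖ ≤ R}.indicator (fun w ↦ ⟪u, (w : V)⟫_ℝ ^ 2) w with hg
  have hg_bdd : ∀ w, |g w| ≤ R ^ 2 := by
    intro w
    simp only [hg, Set.indicator, Set.mem_setOf_eq]
    split_ifs with hw
    · rw [abs_of_nonneg (sq_nonneg _)]
      calc ⟪u, (w : V)⟫_ℝ ^ 2 ≤ (‖u‖ * ‖(w : V)‖) ^ 2 := by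
            rw [← sq_abs]; exact pow_le_pow_left₀ (abs_nonneg _) (abs_real_inner_le_norm _ _) 2
        _ ≤ (1 * R) ^ 2 := by gcongr
        _ = R ^ 2 := by ring
    · simp [sq_nonneg]
  have hSg : Summable fun w : Λ ↦ gaussianFunction s⁻¹ (w : V) * g w :=
    summable_gaussianFunction_mul_of_bounded Λ hs' hg_bdd
  have hSZ : Summable fun w : Λ ↦ gaussianFunction s⁻¹ (w : V) :=
    (summable_gaussianFunction_sub Λ hs' (0 : V)).congr fun w ↦ by rw [sub_zero]
  have hScos := summable_gaussianFunction_mul_cos Λ hs' (τ • u)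
  -- pointwise chord bound: `cos(2π τ ⟪u, w⟫) ≤ 1 - 8 τ² g(w)`
  have hpt : ∀ w : Λ, gaussianFunction s⁻¹ (w : V) * Real.cos (2 * π * ⟪τ • u, (w : V)⟫_ℝ) ≤
      gaussianFunction s⁻¹ (w : V) * (1 - 8 * τ ^ 2 * g w) := by
    intro w
    refine mul_le_mul_of_nonneg_left ?_ (gaussianFunction_pos _ _).le
    simp only [hg, Set.indicator, Set.mem_setOf_eq]
    split_ifs with hw
    · have hθ : |2 * π * ⟪τ • u, (w : V)⟫_ℝ| ≤ π := by
        rw [real_inner_smul_left, show 2 * π * (τ * ⟪u, (w : V)⟫_ℝ) = (2 * π * τ) * ⟪u, (w : V)⟫_ℝ by ring,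
          abs_mul, abs_of_pos (by positivity : 0 < 2 * π * τ)]
        have hin : |⟪u, (w : V)⟫_ℝ| ≤ R :=
          (abs_real_inner_le_norm _ _).trans (by nlinarith [norm_nonneg (w : V), norm_nonneg u])
        calc 2 * π * τ * |⟪u, (w : V)⟫_ℝ| ≤ 2 * π * τ * R := by gcongr
          _ = π := by rw [hτ]; field_simp
      have := Real.cos_le_one_sub_mul_cos_sq hθ
      rw [real_inner_smul_left] at this ⊢
      have hid : 2 / π ^ 2 * (2 * π * (τ * ⟪u, (w : V)⟫_ℝ)) ^ 2 = 8 * τ ^ 2 * ⟪u, (w : V)⟫_ℝ ^ 2 := by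
        field_simp
        ring
      linarith
    · simp only [mul_zero, sub_zero]
      exact Real.cos_le_one _
  -- sum the pointwise bound
  have hsum : gaussianFunction s (τ • u) * Z ≤ Z - 8 * τ ^ 2 * ∑' w : Λ, gaussianFunction s⁻¹ (w : V) * g w := by
    calc gaussianFunction s (τ • u) * Z
        ≤ ∑' w : Λ, gaussianFunction s⁻¹ (w : V) * Real.cos (2 * π * ⟪τ • u, (w : V)⟫_ℝ) :=
          gaussianFunction_mul_tsum_le_tsum_mul_cos L hs (τ • u)
      _ ≤ ∑' w : Λ, gaussianFunction s⁻¹ (w : V) * (1 - 8 * τ ^ 2 * g w) :=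
          Summable.tsum_le_tsum hpt hScos (by
            have := hSZ.sub (hSg.mul_left (8 * τ ^ 2))
            refine this.congr fun w ↦ ?_
            ring)
      _ = Z - 8 * τ ^ 2 * ∑' w : Λ, gaussianFunction s⁻¹ (w : V) * g w := by
          rw [show (fun w : Λ ↦ gaussianFunction s⁻¹ (w : V) * (1 - 8 * τ ^ 2 * g w)) =
              fun w : Λ ↦ gaussianFunction s⁻¹ (w : V) - 8 * τ ^ 2 * (gaussianFunction s⁻¹ (w : V) * g w) by
            funext w; ring]
          rw [hSZ.tsum_sub (hSg.mul_left _), tsum_mul_left]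
  -- `1 - ρ_s(τ u) ≤ π τ² ‖u‖²/s² ≤ π τ²/s²`
  have hexp : 1 - gaussianFunction s (τ • u) ≤ π * τ ^ 2 / s ^ 2 := by
    rw [gaussianFunction, norm_smul, Real.norm_eq_abs, abs_of_pos hτ0,
      show -π * (τ * ‖u‖) ^ 2 / s ^ 2 = -(π * (τ * ‖u‖) ^ 2 / s ^ 2) by ring]
    have h1 := Real.add_one_le_exp (-(π * (τ * ‖u‖) ^ 2 / s ^ 2))
    have h2 : (τ * ‖u‖) ^ 2 ≤ τ ^ 2 := by
      rw [mul_pow]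
      exact mul_le_of_le_one_right (sq_nonneg _) (by nlinarith [norm_nonneg u])
    have h3 : π * (τ * ‖u‖) ^ 2 / s ^ 2 ≤ π * τ ^ 2 / s ^ 2 := by gcongr
    linarith
  have hZ0 : 0 ≤ Z := tsum_nonneg fun w ↦ (gaussianFunction_pos _ _).le
  -- conclude: `8 τ² T ≤ Z (1 - ρ_s(τu)) ≤ Z π τ²/s²`
  have h8 : 8 * τ ^ 2 * ∑' w : Λ, gaussianFunction s⁻¹ (w : V) * g w ≤ π * τ ^ 2 / s ^ 2 * Z := by
    nlinarith [mul_le_mul_of_nonneg_left hexp hZ0]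
  have hτ2 : 0 < τ ^ 2 := by positivity
  have hs2 : 0 < s ^ 2 := by positivity
  rw [show π / (8 * s ^ 2) * Z = (π * τ ^ 2 / s ^ 2 * Z) / (8 * τ ^ 2) by field_simp]
  rw [le_div_iff₀ (by positivity)]
  linarith

/-! ### The distance-to-`ℤ` statistic at a far point -/

/-- **Far points have large expected squared distance to `ℤ` along dual samples**: for every
`x` and `s > 0`, `(1 - f_s(x)) ρ_{1/s}(L*) ≤ 2π² ∑_{w ∈ L*} ρ_{1/s}(w) ‖⟪x, w⟫‖²_{ℝ/ℤ}` where
`f_s(x) = ρ_s(L - x)/ρ_s(L)`, i.e. `E_{w ∼ D_{L*,1/s}}[‖⟪x, w⟫‖²_{ℝ/ℤ}] ≥ (1 - f_s(x))/(2π²)`: by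
`f_s(x) = E cos(2π⟪x, w⟫)` (Claim 4.1) and `cos(2π t) ≥ 1 - 2π²‖t‖²_{ℝ/ℤ}` — the completeness
direction of the cosine-free variant of Aharonov–Regev's test (a) `f_W(v) < 1/2`, where
`f_s(x) ≤ 2^{-Ω(n)}` at points far from `L` (Lemma 3.1).
[cite: AharonovRegev2005, Claim 4.1, Lemma 1.3 and Claim 6.1 (pp. 9–11) — variant] -/
theorem one_sub_div_mul_tsum_le_tsum_mul_distInt_sq {s : ℝ} (hs : 0 < s) (x : V) :
    (1 - (∑' y : L, gaussianFunction s ((y : V) - x)) / ∑' y : L, gaussianFunction s (y : V)) *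
        ∑' w : dualLattice L, gaussianFunction s⁻¹ (w : V) ≤
      2 * π ^ 2 * ∑' w : dualLattice L, gaussianFunction s⁻¹ (w : V) * distInt ⟪x, (w : V)⟫_ℝ ^ 2 := by
  set Λ := dualLattice L
  have hs' : s⁻¹ ≠ 0 := inv_ne_zero hs.ne'
  set Z : ℝ := ∑' w : Λ, gaussianFunction s⁻¹ (w : V) with hZdef
  have hZ' : 0 < Z := by
    have := tsum_gaussianFunction_sub_pos Λ hs' (0 : V)
    simpa only [sub_zero] using this
  have hSZ : Summable fun w : Λ ↦ gaussianFunction s⁻¹ (w : V) :=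
    (summable_gaussianFunction_sub Λ hs' (0 : V)).congr fun w ↦ by rw [sub_zero]
  have hSd : Summable fun w : Λ ↦ gaussianFunction s⁻¹ (w : V) * distInt ⟪x, (w : V)⟫_ℝ ^ 2 :=
    summable_gaussianFunction_mul_of_bounded Λ hs' (C := 1 / 4) fun w ↦ by
      rw [abs_of_nonneg (sq_nonneg _)]
      have h := distInt_le_half ⟪x, (w : V)⟫_ℝ
      have h0 := distInt_nonneg ⟪x, (w : V)⟫_ℝ
      nlinarith
  have hScos := summable_gaussianFunction_mul_cos Λ hs' x
  -- `f_s(x) Z = ∑ ρ_{1/s}(w) cos(2π⟪x, w⟫)`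
  have hf : (∑' y : L, gaussianFunction s ((y : V) - x)) / (∑' y : L, gaussianFunction s (y : V)) * Z =
      ∑' w : Λ, gaussianFunction s⁻¹ (w : V) * Real.cos (2 * π * ⟪x, (w : V)⟫_ℝ) := by
    rw [tsum_gaussianFunction_sub_div_eq L hs x, div_mul_cancel₀ _ hZ'.ne']
  -- pointwise `ρ(w)(1 - 2π² d²) ≤ ρ(w) cos`
  have hpt : ∀ w : Λ, gaussianFunction s⁻¹ (w : V) * (1 - 2 * π ^ 2 * distInt ⟪x, (w : V)⟫_ℝ ^ 2) ≤
      gaussianFunction s⁻¹ (w : V) * Real.cos (2 * π * ⟪x, (w : V)⟫_ℝ) := fun w ↦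
    mul_le_mul_of_nonneg_left (one_sub_mul_distInt_sq_le_cos _) (gaussianFunction_pos _ _).le
  have hsum : Z - 2 * π ^ 2 * ∑' w : Λ, gaussianFunction s⁻¹ (w : V) * distInt ⟪x, (w : V)⟫_ℝ ^ 2 ≤
      ∑' w : Λ, gaussianFunction s⁻¹ (w : V) * Real.cos (2 * π * ⟪x, (w : V)⟫_ℝ) := by
    calc Z - 2 * π ^ 2 * ∑' w : Λ, gaussianFunction s⁻¹ (w : V) * distInt ⟪x, (w : V)⟫_ℝ ^ 2
        = ∑' w : Λ, gaussianFunction s⁻¹ (w : V) * (1 - 2 * π ^ 2 * distInt ⟪x, (w : V)⟫_ℝ ^ 2) := by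
          rw [show (fun w : Λ ↦ gaussianFunction s⁻¹ (w : V) * (1 - 2 * π ^ 2 * distInt ⟪x, (w : V)⟫_ℝ ^ 2)) =
              fun w : Λ ↦ gaussianFunction s⁻¹ (w : V) -
                2 * π ^ 2 * (gaussianFunction s⁻¹ (w : V) * distInt ⟪x, (w : V)⟫_ℝ ^ 2) by
            funext w; ring]
          rw [hSZ.tsum_sub (hSd.mul_left _), tsum_mul_left]
      _ ≤ _ := Summable.tsum_le_tsum hpt (by
            have := hSZ.sub (hSd.mul_left (2 * π ^ 2))
            refine this.congr fun w ↦ ?_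
            ring) hScos
  rw [← hf] at hsum
  nlinarith

end Literature.Algebra.EuclideanLattices

end
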